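import Literature.Analysis.FluidPDE.FluidComputer.EnstrophyCurvature
import Literature.Analysis.FluidPDE.FluidComputer.ClassicalLatticeSpectra

/-!
# Taylor & Green (1937), eq. (47): the `T²` coefficient `5/48 + 18/R²` of the Taylor–Green dissipation series is a theorem of the truncated system

HONEST FRAMING (cell `pub-fluidc`, verbatim): *low prior, high value-of-information experiment on
Tao's machine paradigm; NOT a claim that NS blows up.* Nothing here concerns the Navier–Stokes PDE
beyond the Galerkin-truncated ODE system of `GalerkinEnergyBalance` / `EnstrophyCurvature`.

Taylor & Green expanded the flow from the datum `u = A cos ax sin ay sin az, v = -A sin ax cos ay sin az,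
w = 0` in powers of `t` and printed the mean dissipation `W = μ⟨ω²⟩` as `W = (3A²a²μ/4)·W'`,
  `W' = 1 - 6T/R + (5/48 + 18/R²) T² - (5/3 + 36/R²) T³/R + …`, `T = Aat`, `R = A/(aν)`
[cite: TaylorGreen1937, eq. (47) p. 511] (the first approximation to the velocity, with its
`sin 2ax cos 2az` structure, is their eq. (21) p. 504). In the cell's units (`A = a = 1`, the phase-shifted
form `u = (sin x cos y cos z, -cos x sin y cos z, 0)` of [cite: VanReesEtAl2011VortexSpectral, §3.1 eq. (10)]
held in `ClassicalLatticeSpectra.TaylorGreenHat.tg`) this reads `Z(t)/Z(0) = 1 - 6νt + (5/48 + 18ν²)t² - …`.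
The linear coefficient is `ClassicalLatticeSpectra.hasDerivAt_truncEnstrophy_tg` (`Ż_S(0) = -(9/4)ν =
-6ν·Z(0)`). THIS FILE PROVES THE QUADRATIC ONE for the truncated system: along ANY unforced Galerkin
solution supported in a mode set `S` containing the eight Taylor–Green modes `(±1,±1,±1)` AND the eight
modes `(±2,0,±2), (0,±2,±2)` that the nonlinearity excites first (`rateModes`), started from the
Taylor–Green datum,

  **`Z̈_S(0) = 5/64 + (27/2)ν² = 2·(5/48 + 18ν²)·Z_S(0)`**, `Z_S(0) = 3/8`
  (`hasDerivAt_deriv_truncEnstrophy_tg`, `hasDerivAt_deriv_truncEnstrophy_tg_TG37`; Euler: `5/64`,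
  `hasDerivAt_deriv_truncEnstrophy_tg_euler`),

i.e. Taylor & Green's `T²` coefficient, both its inviscid part `5/48` (their triple-correlation computation)
and its viscous part `18/R²`, with no `O(ν)` cross term — exactly as printed. It is the evaluation of
`EnstrophyCurvature.hasDerivAt_deriv_truncEnstrophy_singleShell'` (`Z̈_S = 4ν²λ²Z_S + Σ_{k∈S}(|k|²-λ)|P_k N_S(k)|²`,
`λ = 3`) on the datum: the truncated advection term of `tg` in closed form (`advection_tg_of_mem_cube`:
`N̂(k) = (i k₀/32·[k₁ = 0]·(1 + [k₂ = 0]), i k₁/32·[k₀ = 0]·(1 + [k₂ = 0]), 0)` on `{0,±2}³`, zero elsewhere,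
`advection_tg_eq_zero_of_not_mem_cube`; in physical space `-(u·∇)u = -¼(sin 2x (1 + cos 2z), sin 2y (1 + cos 2z), 0)`),
whose Leray projection lives on `rateModes` with `|P_k N̂(k)|² = 1/512`, `|k|² = 8`, so that
`Q = 8 · (8 - 3) · 1/512 = 5/64` (`curvatureQ_tg`). On the MINIMAL truncation `S = (±1,±1,±1)` the excited
modes are absent, `Q = 0` and `Z̈_S(0) = (27/2)ν²` only (`curvatureQ_tg_modes`,
`hasDerivAt_deriv_truncEnstrophy_tg_minimal`): the hypothesis `rateModes ⊆ S` is what carries the `5/48`.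

For the cell (HOME/LITERATURE.md §C13): every Taylor–Green gate run of both engines (128³–512³, f32/f64)
returns `Z″(0)/Z(0) = 0.2083` from its first three diagnostic rows against `2(5/48 + 18ν²) = 0.20835`
(Re 1600), and the CL-tg Euler controls `0.2083–0.2084 = 5/24`; with this file that check compares the
engines against a theorem of the very ODE system they integrate, not only against the 1937 series.
No named facts (D-0026); the Kida–Pelz analogue (`193/90`, no printed closed form known) is not attempted.
-/

noncomputable section

namespace Literature.Analysis.FluidPDE.FluidComputer

open Complex ComplexConjugate Finset
open scoped BigOperators

namespace ShellTransfer

namespace TaylorGreenHat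

/-! ## The truncated advection term of the Taylor–Green datum -/

/-- The coefficients as a single `if`. [folklore] -/
theorem coeff_eq_ite (q : Fin 3 → ℤ) (j : Fin 3) :
    tg.coeff q j = if q ∈ modes then ![-I * ((q 0 : ℤ) : ℂ) / 8, I * ((q 1 : ℤ) : ℂ) / 8, 0] j else 0 := rfl

/-- The truncated advection term of `tg` on any mode set containing the eight modes is the 8-term sum
over the giving modes `p = (±1,±1,±1)`. [folklore] -/
theorem advection_tg_eq {S : Finset (Fin 3 → ℤ)} (hS : modes ⊆ S) (k : Fin 3 → ℤ) (j : Fin 3) :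
    advection tg S k j = -I * ∑ a ∈ pmOne, ∑ b ∈ pmOne, ∑ c ∈ pmOne,
      kdot k (tg.coeff (k - ![a, b, c])) * (![-I * (a : ℂ) / 8, I * (b : ℂ) / 8, 0] j) := by
  unfold advection
  congr 1
  rw [← Finset.sum_subset hS (fun p _ hp => by rw [coeff_of_not_mem hp]; simp)]
  rw [sum_modes]
  refine Finset.sum_congr rfl fun a ha => Finset.sum_congr rfl fun b hb =>
    Finset.sum_congr rfl fun c hc => ?_
  rw [coeff_of_mem (vec_mem_modes ha hb hc)]
  simp

/-- `{0, 2, -2} ⊂ ℤ`. [folklore] -/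
def zpmTwo : Finset ℤ := {0, 2, -2}

/-- `a ∈ {0,2,-2} ↔ a = 0 ∨ a = 2 ∨ a = -2`. [folklore] -/
theorem mem_zpmTwo {a : ℤ} : a ∈ zpmTwo ↔ a = 0 ∨ a = 2 ∨ a = -2 := by
  unfold zpmTwo; simp

/-- The 27 wavevectors `{0,±2}³` = all sums of two Taylor–Green modes. [folklore] -/
def cube : Finset (Fin 3 → ℤ) := KidaPelzHat.box zpmTwo zpmTwo zpmTwo

/-- Membership in the cube is entrywise. [folklore] -/
theorem mem_cube {k : Fin 3 → ℤ} : k ∈ cube ↔ k 0 ∈ zpmTwo ∧ k 1 ∈ zpmTwo ∧ k 2 ∈ zpmTwo :=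
  KidaPelzHat.mem_box

/-- `x - a = ±1` and `a = ±1` force `x ∈ {0, ±2}`. [folklore] -/
theorem mem_zpmTwo_of_sub {x a : ℤ} (h1 : x - a ∈ pmOne) (h2 : a ∈ pmOne) : x ∈ zpmTwo := by
  rw [mem_pmOne] at h1 h2
  rw [mem_zpmTwo]
  omega

/-- A receiving mode fed by two Taylor–Green modes lies in the cube: `p, k - p ∈ modes ⇒ k ∈ {0,±2}³`.
[folklore] -/
theorem mem_cube_of_mediator {k p : Fin 3 → ℤ} (hp : p ∈ modes) (hq : k - p ∈ modes) : k ∈ cube := by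
  rw [mem_modes] at hp hq
  simp only [Pi.sub_apply] at hq
  exact mem_cube.mpr ⟨mem_zpmTwo_of_sub hq.1 hp.1, mem_zpmTwo_of_sub hq.2.1 hp.2.1,
    mem_zpmTwo_of_sub hq.2.2 hp.2.2⟩

/-- **Off the cube the truncated advection term of `tg` vanishes** (no pair of carried modes adds up
to `k`). [folklore] -/
theorem advection_tg_eq_zero_of_not_mem_cube {S : Finset (Fin 3 → ℤ)} (hS : modes ⊆ S) {k : Fin 3 → ℤ}
    (hk : k ∉ cube) : advection tg S k = 0 := by
  funext j
  rw [advection_tg_eq hS]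
  have hz : ∀ a ∈ pmOne, ∀ b ∈ pmOne, ∀ c ∈ pmOne,
      kdot k (tg.coeff (k - ![a, b, c])) * (![-I * (a : ℂ) / 8, I * (b : ℂ) / 8, 0] j) = 0 := by
    intro a ha b hb c hc
    have hq : k - ![a, b, c] ∉ modes := fun hq => hk (mem_cube_of_mediator (vec_mem_modes ha hb hc) hq)
    rw [coeff_of_not_mem hq]
    unfold kdot
    simp
  rw [Finset.sum_congr rfl fun a ha => Finset.sum_congr rfl fun b hb =>
    Finset.sum_congr rfl fun c hc => hz a ha b hb c hc]
  simp

/-- **The truncated advection term of the Taylor–Green datum in closed form** on the cube: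
`N̂(k) = ( i k₀/32 · [k₁ = 0] · (1 + [k₂ = 0]),  i k₁/32 · [k₀ = 0] · (1 + [k₂ = 0]),  0 )`, i.e. the
Fourier coefficients of `-(u·∇)u = -¼ (sin 2x (1 + cos 2z), sin 2y (1 + cos 2z), 0)`. [folklore] -/
def advTG (k : Fin 3 → ℤ) : Fin 3 → ℂ :=
  ![if k 1 = 0 then I * ((k 0 : ℤ) : ℂ) / 32 * (if k 2 = 0 then 2 else 1) else 0,
    if k 0 = 0 then I * ((k 1 : ℤ) : ℂ) / 32 * (if k 2 = 0 then 2 else 1) else 0,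
    0]

set_option maxHeartbeats 4000000 in
/-- The 27 evaluations: on the cube `N_S(tg)(k) = advTG k`. [folklore] -/
theorem advection_tg_vec {S : Finset (Fin 3 → ℤ)} (hS : modes ⊆ S) {a b c : ℤ} (ha : a ∈ zpmTwo)
    (hb : b ∈ zpmTwo) (hc : c ∈ zpmTwo) : advection tg S ![a, b, c] = advTG ![a, b, c] := by
  rcases mem_zpmTwo.mp ha with rfl | rfl | rfl <;> rcases mem_zpmTwo.mp hb with rfl | rfl | rfl <;>
    rcases mem_zpmTwo.mp hc with rfl | rfl | rfl
  all_goals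
    funext j
    fin_cases j
    all_goals
      norm_num [advection_tg_eq hS, advTG, sum_pmOne, kdot, Fin.sum_univ_three, coeff_eq_ite, mem_modes,
        mem_pmOne, Pi.sub_apply, Matrix.cons_val_zero, Matrix.cons_val_one, Matrix.head_cons,
        Matrix.cons_val_two, Matrix.tail_cons, Complex.ext_iff]

/-- `N_S(tg)(k) = advTG k` for every `k` in the cube. [folklore] -/
theorem advection_tg_of_mem_cube {S : Finset (Fin 3 → ℤ)} (hS : modes ⊆ S) {k : Fin 3 → ℤ}
    (hk : k ∈ cube) : advection tg S k = advTG k := by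
  obtain ⟨h0, h1, h2⟩ := mem_cube.mp hk
  rw [← vec3_eta k]
  exact advection_tg_vec hS h0 h1 h2

/-! ## The eight excited modes and the curvature functional -/

/-- `{2, -2} ⊂ ℤ`. [folklore] -/
def pmTwo : Finset ℤ := {2, -2}

/-- `a ∈ {2,-2} ↔ a = 2 ∨ a = -2`. [folklore] -/
theorem mem_pmTwo {a : ℤ} : a ∈ pmTwo ↔ a = 2 ∨ a = -2 := by
  unfold pmTwo; simp

/-- `Σ_{a∈{2,-2}} h a = h 2 + h (-2)`. [folklore] -/
theorem sum_pmTwo {M : Type*} [AddCommMonoid M] (h : ℤ → M) : ∑ a ∈ pmTwo, h a = h 2 + h (-2) :=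
  Finset.sum_pair (by decide)

/-- **The eight modes excited first**: `(±2, 0, ±2) ∪ (0, ±2, ±2)` — the support of the Leray-projected
advection term `P N_S(tg)`, `|k|² = 8` (in physical space the inviscid `∂ₜu(0) =
-(1/8)(sin 2x cos 2z, sin 2y cos 2z, -(cos 2x + cos 2y) sin 2z)`; cf. the first approximation
[cite: TaylorGreen1937, eq. (21) p. 504]). [folklore] -/
def rateModes : Finset (Fin 3 → ℤ) :=
  KidaPelzHat.box pmTwo {0} pmTwo ∪ KidaPelzHat.box {0} pmTwo pmTwo

/-- Membership is entrywise. [folklore] -/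
theorem mem_rateModes {k : Fin 3 → ℤ} : k ∈ rateModes ↔
    (k 0 ∈ pmTwo ∧ k 1 = 0 ∧ k 2 ∈ pmTwo) ∨ (k 0 = 0 ∧ k 1 ∈ pmTwo ∧ k 2 ∈ pmTwo) := by
  unfold rateModes
  rw [Finset.mem_union, KidaPelzHat.mem_box, KidaPelzHat.mem_box, Finset.mem_singleton,
    Finset.mem_singleton]

/-- `{2,-2} ⊆ {0,2,-2}`. [folklore] -/
theorem mem_zpmTwo_of_mem_pmTwo {a : ℤ} (h : a ∈ pmTwo) : a ∈ zpmTwo := by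
  rw [mem_pmTwo] at h; rw [mem_zpmTwo]; tauto

/-- `0 ∈ {0,2,-2}`. [folklore] -/
theorem zero_mem_zpmTwo : (0 : ℤ) ∈ zpmTwo := by rw [mem_zpmTwo]; tauto

/-- The excited modes lie in the cube. [folklore] -/
theorem rateModes_subset_cube : rateModes ⊆ cube := by
  intro k hk
  rw [mem_cube]
  rcases mem_rateModes.mp hk with ⟨h0, h1, h2⟩ | ⟨h0, h1, h2⟩
  · exact ⟨mem_zpmTwo_of_mem_pmTwo h0, h1 ▸ zero_mem_zpmTwo, mem_zpmTwo_of_mem_pmTwo h2⟩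
  · exact ⟨h0 ▸ zero_mem_zpmTwo, mem_zpmTwo_of_mem_pmTwo h1, mem_zpmTwo_of_mem_pmTwo h2⟩

/-- The two boxes making up `rateModes` are disjoint (first entry `±2` vs `0`). [folklore] -/
theorem disjoint_rateBoxes : Disjoint (KidaPelzHat.box pmTwo {0} pmTwo) (KidaPelzHat.box {0} pmTwo pmTwo) := by
  rw [Finset.disjoint_left]
  intro k h1 h2
  rw [KidaPelzHat.mem_box] at h1 h2
  rw [Finset.mem_singleton] at h2
  have := h1.1
  rw [h2.1, mem_pmTwo] at this
  omega

set_option maxHeartbeats 4000000 in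
/-- The 27 per-mode curvature terms: `(|k|² - 3)|P_k N̂(k)|² = 5/512` on the eight excited modes and `0`
on the other nineteen cube modes (where `N̂(k)` vanishes or is a pure gradient, `k = (±2,0,0), (0,±2,0)`).
[folklore] -/
theorem curvatureTerm_vec {a b c : ℤ} (ha : a ∈ zpmTwo) (hb : b ∈ zpmTwo) (hc : c ∈ zpmTwo) :
    (knormSq ![a, b, c] - 3) * ∑ j, Complex.normSq (leray ![a, b, c] (advTG ![a, b, c]) j) =
      if (![a, b, c] : Fin 3 → ℤ) ∈ rateModes then 5 / 512 else 0 := by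
  rcases mem_zpmTwo.mp ha with rfl | rfl | rfl <;> rcases mem_zpmTwo.mp hb with rfl | rfl | rfl <;>
    rcases mem_zpmTwo.mp hc with rfl | rfl | rfl
  all_goals
    norm_num [advTG, leray_apply, kdot, knormSq, Fin.sum_univ_three, mem_rateModes, mem_pmTwo,
      Matrix.cons_val_zero, Matrix.cons_val_one, Matrix.head_cons, Matrix.cons_val_two, Matrix.tail_cons,
      Complex.normSq_apply, Complex.ext_iff]

/-- Every per-mode term of `Q_S(tg)`, for any mode set containing the eight Taylor–Green modes:
`(|k|² - 3)|P_k N_S(tg)(k)|² = 5/512 · [k ∈ rateModes]`. [folklore] -/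
theorem curvatureTerm_eq {S : Finset (Fin 3 → ℤ)} (hS : modes ⊆ S) (k : Fin 3 → ℤ) :
    (knormSq k - 3) * ∑ j, Complex.normSq (leray k (advection tg S k) j) =
      if k ∈ rateModes then 5 / 512 else 0 := by
  by_cases hk : k ∈ cube
  · rw [advection_tg_of_mem_cube hS hk]
    obtain ⟨h0, h1, h2⟩ := mem_cube.mp hk
    rw [← vec3_eta k]
    exact curvatureTerm_vec h0 h1 h2
  · rw [advection_tg_eq_zero_of_not_mem_cube hS hk, leray_zero,
      if_neg fun h => hk (rateModes_subset_cube h)]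
    simp

/-- **`Q_S(tg) = 5/64`** on every mode set containing the Taylor–Green modes and the eight excited modes
(`8 × 5/512`). [folklore] -/
theorem curvatureQ_tg {S : Finset (Fin 3 → ℤ)} (hS : modes ⊆ S) (hR : rateModes ⊆ S) :
    curvatureQ tg S 3 = 5 / 64 := by
  unfold curvatureQ
  rw [Finset.sum_congr rfl fun k _ => curvatureTerm_eq hS k,
    ← Finset.sum_subset hR fun k _ hk => if_neg hk,
    Finset.sum_congr rfl fun k hk => if_pos hk, Finset.sum_const, nsmul_eq_mul]
  have hcard : rateModes.card = 8 := by
    unfold rateModes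
    rw [Finset.card_union_of_disjoint disjoint_rateBoxes]
    unfold KidaPelzHat.box
    rw [Finset.card_image_of_injective _ vec3_injective, Finset.card_image_of_injective _ vec3_injective]
    decide
  rw [hcard]
  norm_num

/-- On the MINIMAL truncation `S = (±1,±1,±1)` the advection term vanishes on `S` (no carried mode is a
sum of two carried modes) and `Q = 0`: the eight-mode Galerkin system is pure viscous decay. [folklore] -/
theorem curvatureQ_tg_modes : curvatureQ tg modes 3 = 0 := by
  unfold curvatureQ
  refine Finset.sum_eq_zero fun k hk => ?_
  have hkc : k ∉ cube := by
    intro hc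
    have h0 := (mem_cube.mp hc).1
    have h0' := (mem_modes.mp hk).1
    rw [mem_zpmTwo] at h0
    rw [mem_pmOne] at h0'
    omega
  rw [advection_tg_eq_zero_of_not_mem_cube (subset_refl _) hkc, leray_zero]
  simp

/-! ## Taylor & Green's `T²` coefficient -/

/-- **`Z̈_S(0) = 5/64 + (27/2)ν²` from the Taylor–Green datum**, along any unforced Galerkin solution
supported in a mode set `S ⊇ (±1,±1,±1) ∪ (±2,0,±2) ∪ (0,±2,±2)` (`4ν²·9·(3/8) + 5/64`).
[cite: TaylorGreen1937, eq. (47) p. 511] -/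
theorem hasDerivAt_deriv_truncEnstrophy_tg {U : ℝ → FourierVelocity} {S : Finset (Fin 3 → ℤ)} {ν : ℝ}
    {c : ℝ → (Fin 3 → ℤ) → ℂ} (hU : IsGalerkinSolution U S ν c fun _ _ _ => 0)
    (hsupp : IsSupportedOn U S) (h0 : U 0 = tg) (hS : modes ⊆ S) (hR : rateModes ⊆ S) :
    HasDerivAt (deriv fun s => truncEnstrophy (U s) S) (5 / 64 + 27 / 2 * ν ^ 2) 0 := by
  have h := hasDerivAt_deriv_truncEnstrophy_singleShell' hU hsupp 0 (lam := 3)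
    (by rw [h0]; exact tg_isSingleShell)
  rw [h0, truncEnstrophy_tg_of_subset hS, curvatureQ_tg hS hR] at h
  convert h using 1
  ring

/-- **Taylor & Green 1937, eq. (47), to second order**: `Z̈_S(0) = 2·(5/48 + 18ν²)·Z_S(0)` — the printed
`T²` coefficient `5/48 + 18/R²` of `W'`, inviscid part AND viscous part, with no `O(ν)` cross term, is a
theorem of the truncated system (together with `Ż_S(0) = -6ν·Z_S(0)`,
`ClassicalLatticeSpectra.hasDerivAt_truncEnstrophy_tg`). [cite: TaylorGreen1937, eq. (47) p. 511] -/
theorem hasDerivAt_deriv_truncEnstrophy_tg_TG37 {U : ℝ → FourierVelocity} {S : Finset (Fin 3 → ℤ)}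
    {ν : ℝ} {c : ℝ → (Fin 3 → ℤ) → ℂ} (hU : IsGalerkinSolution U S ν c fun _ _ _ => 0)
    (hsupp : IsSupportedOn U S) (h0 : U 0 = tg) (hS : modes ⊆ S) (hR : rateModes ⊆ S) :
    HasDerivAt (deriv fun s => truncEnstrophy (U s) S)
      (2 * (5 / 48 + 18 * ν ^ 2) * truncEnstrophy (U 0) S) 0 := by
  have h := hasDerivAt_deriv_truncEnstrophy_tg hU hsupp h0 hS hR
  rw [h0, truncEnstrophy_tg_of_subset hS]
  convert h using 1
  ring

/-- The truncated-Euler case: the Taylor–Green enstrophy starts as the parabola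
`Z_S(t) = 3/8 + (5/128)t² + o(t²)`, i.e. `Ż_S(0) = 0`, `Z̈_S(0) = 5/64` (`Z̈/Z = 5/24 = 2·5/48`).
[cite: TaylorGreen1937, eq. (47) p. 511] -/
theorem hasDerivAt_deriv_truncEnstrophy_tg_euler {U : ℝ → FourierVelocity} {S : Finset (Fin 3 → ℤ)}
    {c : ℝ → (Fin 3 → ℤ) → ℂ} (hU : IsGalerkinSolution U S 0 c fun _ _ _ => 0)
    (hsupp : IsSupportedOn U S) (h0 : U 0 = tg) (hS : modes ⊆ S) (hR : rateModes ⊆ S) :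
    HasDerivAt (deriv fun s => truncEnstrophy (U s) S) (5 / 64) 0 := by
  have h := hasDerivAt_deriv_truncEnstrophy_tg hU hsupp h0 hS hR
  norm_num at h
  exact h

/-- Contrast: on the MINIMAL truncation `S = (±1,±1,±1)` (the excited modes absent) the same solution
concept gives `Z̈_S(0) = (27/2)ν²` only — the `5/48` lives in the modes `rateModes`. [folklore] -/
theorem hasDerivAt_deriv_truncEnstrophy_tg_minimal {U : ℝ → FourierVelocity} {ν : ℝ}
    {c : ℝ → (Fin 3 → ℤ) → ℂ} (hU : IsGalerkinSolution U modes ν c fun _ _ _ => 0)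
    (hsupp : IsSupportedOn U modes) (h0 : U 0 = tg) :
    HasDerivAt (deriv fun s => truncEnstrophy (U s) modes) (27 / 2 * ν ^ 2) 0 := by
  have h := hasDerivAt_deriv_truncEnstrophy_singleShell' hU hsupp 0 (lam := 3)
    (by rw [h0]; exact tg_isSingleShell)
  rw [h0, truncEnstrophy_tg, curvatureQ_tg_modes] at h
  convert h using 1
  ring

/-! ## Non-vacuity on the minimal truncation: the decaying Taylor–Green mode is an exact Galerkin solution

On `S = (±1,±1,±1)` the truncated advection term of (any multiple of) `tg` vanishes, so
`û(k,t) = e^{-3νt} û_tg(k)` solves the unforced Galerkin system EXACTLY for every `ν`, for all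
`t ∈ ℝ`, with zero pressure multiplier: a witness that the hypotheses of
`hasDerivAt_deriv_truncEnstrophy_tg_minimal` are inhabited, and an independent check of its value
(`Z_S(t) = (3/8)e^{-6νt}` has `Z̈_S(0) = (3/8)·36ν² = (27/2)ν²`). [folklore] -/

/-- Real multiples of a real incompressible coefficient field. [folklore] -/
def scale (r : ℝ) (A : FourierVelocity) : FourierVelocity where
  coeff k j := (r : ℂ) * A.coeff k j
  reality k i := by rw [A.reality, map_mul, Complex.conj_ofReal]
  divFree k := by
    have h := A.divFree k
    have e : ∑ i, ((k i : ℤ) : ℂ) * ((r : ℂ) * A.coeff k i) = (r : ℂ) * ∑ i, ((k i : ℤ) : ℂ) * A.coeff k i := by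
      rw [Finset.mul_sum]
      refine Finset.sum_congr rfl fun i _ => ?_
      ring
    rw [e, h, mul_zero]

/-- Its coefficients. [folklore] -/
@[simp] theorem scale_coeff (r : ℝ) (A : FourierVelocity) (k : Fin 3 → ℤ) (j : Fin 3) :
    (scale r A).coeff k j = (r : ℂ) * A.coeff k j := rfl

/-- The truncated advection term is quadratic: `N_S(rA) = r² N_S(A)`. [folklore] -/
theorem advection_scale (r : ℝ) (A : FourierVelocity) (S : Finset (Fin 3 → ℤ)) (k : Fin 3 → ℤ) (j : Fin 3) :
    advection (scale r A) S k j = (r : ℂ) ^ 2 * advection A S k j := by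
  unfold advection
  have hk : ∀ p, kdot k ((scale r A).coeff (k - p)) = (r : ℂ) * kdot k (A.coeff (k - p)) := by
    intro p
    unfold kdot
    rw [Finset.mul_sum]
    refine Finset.sum_congr rfl fun i _ => ?_
    rw [scale_coeff]
    ring
  have e : ∑ p ∈ S, kdot k ((scale r A).coeff (k - p)) * (scale r A).coeff p j =
      (r : ℂ) ^ 2 * ∑ p ∈ S, kdot k (A.coeff (k - p)) * A.coeff p j := by
    rw [Finset.mul_sum]
    refine Finset.sum_congr rfl fun p _ => ?_
    rw [hk, scale_coeff]
    ring
  rw [e]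
  ring

/-- **The decaying Taylor–Green mode** `û(k,t) = e^{-3νt} û_tg(k)`. [folklore] -/
def tgDecay (ν t : ℝ) : FourierVelocity := scale (Real.exp (-(3 * ν) * t)) tg

/-- Two real incompressible coefficient fields with the same coefficients are equal. [folklore] -/
theorem fourierVelocity_ext {A B : FourierVelocity} (h : A.coeff = B.coeff) : A = B := by
  cases A with
  | mk a ra da =>
    cases B with
    | mk b rb db =>
      have h' : a = b := h
      subst h'
      rfl

/-- `tgDecay ν 0 = tg`. [folklore] -/
theorem tgDecay_zero (ν : ℝ) : tgDecay ν 0 = tg := by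
  refine fourierVelocity_ext ?_
  funext k j
  show ((Real.exp (-(3 * ν) * 0) : ℝ) : ℂ) * tg.coeff k j = tg.coeff k j
  simp

/-- It is supported on the eight modes at all times. [folklore] -/
theorem tgDecay_isSupportedOn (ν : ℝ) : IsSupportedOn (tgDecay ν) modes := by
  intro t k hk
  funext j
  show ((Real.exp (-(3 * ν) * t) : ℝ) : ℂ) * tg.coeff k j = 0
  rw [coeff_of_not_mem hk]
  simp

/-- `|k|² = 3` on the modes. [folklore] -/
theorem knormSq_of_mem_modes {k : Fin 3 → ℤ} (hk : k ∈ modes) : knormSq k = 3 := by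
  obtain ⟨h0, h1, h2⟩ := mem_modes.mp hk
  unfold knormSq
  rw [Fin.sum_univ_three, sq_eq_one_of_mem_pmOne_real h0, sq_eq_one_of_mem_pmOne_real h1,
    sq_eq_one_of_mem_pmOne_real h2]
  norm_num

/-- **The decaying Taylor–Green mode solves the unforced Galerkin system on the minimal truncation
exactly**, for every viscosity and all `t ∈ ℝ` (zero pressure multiplier: the advection term
vanishes identically on `(±1,±1,±1)`). [folklore] -/
theorem tgDecay_isGalerkinSolution (ν : ℝ) :
    IsGalerkinSolution (tgDecay ν) modes ν (fun _ _ => 0) (fun _ _ _ => 0) := by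
  intro t k hk j
  have hkc : k ∉ cube := by
    intro hc
    have h0 := (mem_cube.mp hc).1
    have h0' := (mem_modes.mp hk).1
    rw [mem_zpmTwo] at h0
    rw [mem_pmOne] at h0'
    omega
  have hadv : advection (tgDecay ν t) modes k j = 0 := by
    unfold tgDecay
    rw [advection_scale, advection_tg_eq_zero_of_not_mem_cube (subset_refl _) hkc]
    simp
  have hrhs : galerkinRHS (tgDecay ν t) modes ν ((fun _ _ => (0 : ℂ)) t) ((fun _ _ _ => (0 : ℂ)) t) k j =
      ((-(3 * ν) * Real.exp (-(3 * ν) * t) : ℝ) : ℂ) * tg.coeff k j := by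
    unfold galerkinRHS
    rw [hadv, knormSq_of_mem_modes hk]
    show -(ν : ℂ) * ((3 : ℝ) : ℂ) * (((Real.exp (-(3 * ν) * t) : ℝ) : ℂ) * tg.coeff k j) +
        (0 - 0 * ((k j : ℤ) : ℂ)) + 0 = _
    push_cast
    ring
  rw [hrhs]
  have hfun : (fun s => (tgDecay ν s).coeff k j) = fun s => ((Real.exp (-(3 * ν) * s) : ℝ) : ℂ) * tg.coeff k j := by
    funext s; rfl
  rw [hfun]
  have hd := ((((hasDerivAt_id' t).const_mul (-(3 * ν))).exp).ofReal_comp).mul_const (tg.coeff k j)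
  refine hd.congr_deriv ?_
  push_cast
  ring

/-- Its enstrophy: `Z_S(t) = (3/8) e^{-6νt}`. [folklore] -/
theorem truncEnstrophy_tgDecay (ν t : ℝ) :
    truncEnstrophy (tgDecay ν t) modes = 3 / 8 * Real.exp (-(6 * ν) * t) := by
  have hE : ∀ k, modalEnergy (tgDecay ν t) k = Real.exp (-(3 * ν) * t) ^ 2 * modalEnergy tg k := by
    intro k
    unfold modalEnergy
    simp only [tgDecay, scale_coeff, Complex.normSq_mul, Complex.normSq_ofReal]
    rw [Finset.mul_sum, Finset.mul_sum, Finset.mul_sum]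
    refine Finset.sum_congr rfl fun j _ => ?_
    ring
  unfold truncEnstrophy
  simp_rw [hE]
  have e : ∑ k ∈ modes, knormSq k * (Real.exp (-(3 * ν) * t) ^ 2 * modalEnergy tg k) =
      Real.exp (-(3 * ν) * t) ^ 2 * truncEnstrophy tg modes := by
    unfold truncEnstrophy
    rw [Finset.mul_sum]
    refine Finset.sum_congr rfl fun k _ => ?_
    ring
  rw [e, truncEnstrophy_tg, sq, ← Real.exp_add]
  ring_nf

/-- **Non-vacuity and cross-check**: the minimal-truncation curvature theorem applies to the decaying
Taylor–Green mode and returns `Z̈_S(0) = (27/2)ν²` — the second derivative of `(3/8)e^{-6νt}` at `0`.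
[folklore] -/
theorem hasDerivAt_deriv_truncEnstrophy_tgDecay (ν : ℝ) :
    HasDerivAt (deriv fun s => truncEnstrophy (tgDecay ν s) modes) (27 / 2 * ν ^ 2) 0 :=
  hasDerivAt_deriv_truncEnstrophy_tg_minimal (tgDecay_isGalerkinSolution ν) (tgDecay_isSupportedOn ν)
    (tgDecay_zero ν)

end TaylorGreenHat

end ShellTransfer

end Literature.Analysis.FluidPDE.FluidComputer

end
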